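import Mathlib
import HarnessLib
import Summits.AnomalousDissipation.AnomalousDissipation.Theses.ImpulseGrid
import Literature.Analysis.FluidPDE.LinearizedNSTorus
import Literature.Analysis.FluidPDE.TorusClassicalLerayHopfProofs
import Literature.Analysis.FluidPDE.LongTimeAveragePeriodic
import Summits.AnomalousDissipation.AnomalousDissipation.Theorems.ImpulseGridBoundedEnergyGridStubColumnarOfPlanar
import Summits.AnomalousDissipation.AnomalousDissipation.Theorems.ImpulseGridBoundedEnergyGridStubAxisZeroOfAxisTwo
import Summits.AnomalousDissipation.AnomalousDissipation.Theorems.ImpulseGridBoundedEnergyGridStubGridOfColumnar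

/-!
# `ImpulseGrid.BoundedEnergyGrid` from the planar bounded steady branch (line `Sketch`, crux
# stmt-AnomalousDissipation-10430): the sorry-free reduction

Support file for the crux `Summit.AnomalousDissipation.AnomalousDissipation.Theses.ImpulseGrid.BoundedEnergyGrid`
(item stmt-AnomalousDissipation-10430). It composes the three landed plumbing stubs of the line `Sketch`
(`Cruxes/BoundedEnergyGrid/Lines/Sketch.lean`) —
`stub_columnarOfPlanar` (2½-D lift `Torus.twoHalf v 0`, `ImpulseGridBoundedEnergyGridStubColumnarOfPlanar`),
`stub_axisZeroOfAxisTwo` (coordinate swap `0 ↔ 2`, `ImpulseGridBoundedEnergyGridStubAxisZeroOfAxisTwo`),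
`stub_gridOfColumnar` (Galilean column lift `Φ := 1`, `c := 1`, `u_j := e₀ + V_j`,
`ImpulseGridBoundedEnergyGridStubGridOfColumnar`) — with the transfer "steady classical states are their
own global Leray–Hopf data and the mean energy of a constant path is its energy"
(`IsClassicalNSSolutionOn.isGlobalLerayHopf`, `meanEnergy_eq_of_periodic`), into ONE implication

  `boundedEnergyGrid_of_planarSteadyBranch : PlanarSteadyBranch → BoundedEnergyGrid`,

where the hypothesis (written out, no definition is introduced) is the planar zero-momentum bounded
steady-branch statement — the registered stub `stub_planarSteadyBranch` of the line, i.e. the printed open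
problem "existence of bounded sequences of stationary solutions of the periodic, forced Navier–Stokes
equations" (Constantin–Tarfulea–Vicol, ARMA 2014 / arXiv:1305.7089, p. 3) in its `∃ g` form at zero
momentum: one smooth divergence-free mean-zero planar force `g ≠ 0` on `T²` with, along some `ν_j → 0⁺`,
smooth mean-zero steady states `v_j` of `NS_{ν_j}(g)` whose energies `∫‖v_j‖²` are bounded uniformly in `j`.
So the crux closes the moment that planar statement is proved (by any line). This file is CONDITIONAL on
nothing else: no named facts, no definitions, standard axioms.
-/

-- `Summit.<Summit>.<Problem>` is the tree's mandated summit-side namespace (CONVENTIONS §2); for this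
-- single-conjunct summit the two coincide, so the duplicate is deliberate.
set_option linter.dupNamespace false

noncomputable section

open MeasureTheory Filter Topology Set
open Literature.Analysis.FunctionSpaces Literature.Analysis.FunctionSpaces.Torus
open Literature.Analysis.FluidPDE Literature.Analysis.FluidPDE.Torus

namespace Summit.AnomalousDissipation.AnomalousDissipation.Theorems

/-- **Steady grid branch ⇒ `BoundedEnergyGrid`** (the transfer of idea card
`columnar-collapse-steady-branch`, ideator 2, proved there): the design clauses of `BoundedEnergyGrid`
verbatim together with STEADY smooth states `u_j` of `NS_{ν_j}(Φ•G)` of momentum `c e₀` and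
`∫‖u_j‖² ≤ E` give the crux — a steady classical state is a global Leray–Hopf solution from its own datum
(`IsClassicalNSSolutionOn.isGlobalLerayHopf`) and the mean energy of the constant path is `∫‖u_j‖²`
(`meanEnergy_eq_of_periodic` with period `1`). [folklore] -/
theorem boundedEnergyGrid_of_steadyGridBranch
    (h : ∃ (Φ : UnitAddTorus (Fin 3) → ℝ) (G : UnitAddTorus (Fin 3) → EuclideanSpace ℝ (Fin 3)) (c : ℝ),
      IsSmooth Φ ∧ IsSmooth G ∧
      (∀ (s : UnitAddCircle) x, Φ (x + Pi.single (1 : Fin 3) s) = Φ x ∧ Φ (x + Pi.single (2 : Fin 3) s) = Φ x) ∧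
      (∫ x, Φ x = 1) ∧ (∀ (s : UnitAddCircle) x, G (x + Pi.single (0 : Fin 3) s) = G x) ∧ (∀ x, G x 0 = 0) ∧
      IsSmooth (fun x => Φ x • G x) ∧ IsDivFree (fun x => Φ x • G x) ∧
      HasZeroMean (fun x => Φ x • G x) ∧ (fun x => Φ x • G x) ≠ 0 ∧ 0 < c ∧
      ∃ (ν : ℕ → ℝ) (u : ℕ → UnitAddTorus (Fin 3) → EuclideanSpace ℝ (Fin 3))
        (p : ℕ → UnitAddTorus (Fin 3) → ℝ),
        (∀ j, 0 < ν j) ∧ Tendsto ν atTop (𝓝 0) ∧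
        (∀ j, IsSteadyNSState (ν j) (fun x => Φ x • G x) (u j) (p j)) ∧
        (∀ j, ∫ x, u j x = c • EuclideanSpace.single 0 1) ∧
        ∃ E : ℝ, ∀ j, ∫ x, ‖u j x‖ ^ 2 ≤ E) :
    Summit.AnomalousDissipation.AnomalousDissipation.Theses.ImpulseGrid.BoundedEnergyGrid := by
  obtain ⟨Φ, G, c, hΦ, hG, hΦinv, hΦmass, hGinv, hG0, hfs, hfd, hfm, hfne, hc, ν, u, p, hν, hν0, hst,
    hmom, E, hE⟩ := h
  refine ⟨Φ, G, c, hΦ, hG, hΦinv, hΦmass, hGinv, hG0, hfs, hfd, hfm, hfne, hc, ν, u, fun j _ => u j, hν,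
    hν0, fun j => (hst j).isGlobalLerayHopf, hmom, E, fun j => ?_⟩
  rw [meanEnergy_eq_of_periodic (τ := 1) (fun _ => rfl) one_pos]
  simpa using hE j

/-- **Planar bounded steady branch ⇒ `BoundedEnergyGrid`** (line `Sketch` of crux
stmt-AnomalousDissipation-10430, sorry-free reduction). If ONE smooth divergence-free mean-zero planar
force `g ≠ 0` on `T²` admits, along some `ν_j → 0⁺`, smooth mean-zero steady states `v_j` of `NS_{ν_j}(g)`
with `∫‖v_j‖² ≤ E` (the Constantin–Tarfulea–Vicol open problem in its `∃ g`, zero-momentum form — the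
registered stub `stub_planarSteadyBranch`), then `ImpulseGrid.BoundedEnergyGrid` holds: lift to a
columnar branch on `T³` (`stub_columnarOfPlanar`, axis `2`), relabel the axes (`stub_axisZeroOfAxisTwo`),
boost along the columns with `Φ ≡ 1`, `c = 1` (`stub_gridOfColumnar`), and transfer
(`boundedEnergyGrid_of_steadyGridBranch`). [folklore] -/
theorem boundedEnergyGrid_of_planarSteadyBranch
    (h : ∃ g : UnitAddTorus (Fin 2) → EuclideanSpace ℝ (Fin 2),
      IsSmooth g ∧ IsDivFree g ∧ HasZeroMean g ∧ g ≠ 0 ∧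
      ∃ (ν : ℕ → ℝ) (v : ℕ → UnitAddTorus (Fin 2) → EuclideanSpace ℝ (Fin 2))
        (p : ℕ → UnitAddTorus (Fin 2) → ℝ),
        (∀ j, 0 < ν j) ∧ Tendsto ν atTop (𝓝 0) ∧
        (∀ j, IsSteadyNSState (ν j) g (v j) (p j)) ∧
        (∀ j, HasZeroMean (v j)) ∧
        ∃ E : ℝ, ∀ j, ∫ x, ‖v j x‖ ^ 2 ≤ E) :
    Summit.AnomalousDissipation.AnomalousDissipation.Theses.ImpulseGrid.BoundedEnergyGrid :=
  boundedEnergyGrid_of_steadyGridBranch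
    (stub_gridOfColumnar (stub_axisZeroOfAxisTwo (stub_columnarOfPlanar h)))

end Summit.AnomalousDissipation.AnomalousDissipation.Theorems

end
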